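import Mathlib
import HarnessLib
import Summits.NavierStokesRegularity.NavierStokesRegularity.Theorems.PoloidalWindowDoorPoloidalWindowRigidityUntwistedLogDerivatives

/-!
# Route `PoloidalWindowDoor`, crux `PoloidalWindowRigidity` (K2, stmt-NavierStokesRegularity-19708), skeleton `lrc-jet` v5,
# stub `stub_untwisted` — brick F4-tr-d (part 3a): ANALYTICITY BOOKKEEPING ALONG A VERTICAL LINE

Cell ns-regularity-ideate, K2 lead ns-poloidal-K2-p1 (gen 6; `--supports stmt-NavierStokesRegularity-19708`, helper; BRIEF-v5-bricks-v2 (S4)).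
Leafwise quantities `z ↦ G(w(y₁ + (z − (y₁)₂)e₂), z)` and partials `z ↦ ∂_c w(y₁ + (z − (y₁)₂)e₂)` are real-analytic in the height when `w` is analytic and
`G` is analytic at the leaf point; the structure quantities `η = Pw + Ld/Λ`, `ξ = Pw − Ld/(1−Λ)`, `c = DP(P,1)`, `Pw` are analytic where `P, Λ` are and
`Λ ∉ {0,1}`.  (Used to produce the derivative chains `d, d′, …, d⁗` and `ε, …, ε‴` demanded by `…UntwistedStuartBranch.stuartBranch_false`.)

WHAT THIS IS NOT: not a claim about Navier–Stokes — calculus bookkeeping (bears_on LADDER-NS N0 via crux K2 = stmt-19708).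
-/

noncomputable section

-- the summit and its single sub-problem share the name (CONVENTIONS §1), as in every Theorems file
set_option linter.dupNamespace false

namespace Summit.NavierStokesRegularity.NavierStokesRegularity.Theorems.PoloidalWindowDoorPoloidalWindowRigidityUntwistedStuartTranslationAnalytic

open Set Function Filter Topology Metric
open Summit.NavierStokesRegularity.NavierStokesRegularity.Theorems.PoloidalWindowDoorPoloidalWindowRigidityUntwistedLogDerivatives

/-! ### Analyticity bookkeeping along the plane -/

/-- A leafwise quantity `z ↦ G(w(y₁ + (z − (y₁)₂)e₂), z)` along a vertical line is analytic at `z` when `w` is analytic and `G` is analytic at the leaf point.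
[folklore] -/
theorem analyticAt_leaf_vline {w : EuclideanSpace ℝ (Fin 3) → ℝ} (hwA : AnalyticOnNhd ℝ w univ) {G : ℝ × ℝ → ℝ}
    (y₁ : EuclideanSpace ℝ (Fin 3)) {z : ℝ}
    (hG : AnalyticAt ℝ G (w (y₁ + (z - y₁ 2) • EuclideanSpace.single (2 : Fin 3) (1 : ℝ)), z)) :
    AnalyticAt ℝ (fun z' : ℝ => G (w (y₁ + (z' - y₁ 2) • EuclideanSpace.single (2 : Fin 3) (1 : ℝ)), z')) z := by
  have hline : AnalyticAt ℝ (fun z' : ℝ => y₁ + (z' - y₁ 2) • EuclideanSpace.single (2 : Fin 3) (1 : ℝ)) z :=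
    analyticAt_const.add ((analyticAt_id.sub analyticAt_const).smul analyticAt_const)
  have hwl : AnalyticAt ℝ (fun z' : ℝ => w (y₁ + (z' - y₁ 2) • EuclideanSpace.single (2 : Fin 3) (1 : ℝ))) z :=
    (hwA _ (mem_univ _)).comp hline
  exact hG.comp₂ hwl analyticAt_id

/-- `z ↦ ∂_c w(y₁ + (z − (y₁)₂)e₂)` is analytic when `w` is. [folklore] -/
theorem analyticAt_partial_vline {w : EuclideanSpace ℝ (Fin 3) → ℝ} (hwA : AnalyticOnNhd ℝ w univ)
    (y₁ c : EuclideanSpace ℝ (Fin 3)) (z : ℝ) :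
    AnalyticAt ℝ (fun z' : ℝ => fderiv ℝ w (y₁ + (z' - y₁ 2) • EuclideanSpace.single (2 : Fin 3) (1 : ℝ)) c) z := by
  have hline : AnalyticAt ℝ (fun z' : ℝ => y₁ + (z' - y₁ 2) • EuclideanSpace.single (2 : Fin 3) (1 : ℝ)) z :=
    analyticAt_const.add ((analyticAt_id.sub analyticAt_const).smul analyticAt_const)
  have hD : AnalyticOnNhd ℝ (fun x => fderiv ℝ w x c) univ := by
    have h1 := (ContinuousLinearMap.apply ℝ ℝ c).comp_analyticOnNhd (AnalyticOnNhd.fderiv hwA)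
    exact AnalyticOnNhd.congr isOpen_univ h1 (fun y _ => by simp [Function.comp])
  exact (hD _ (mem_univ _)).comp hline

/-- The structure quantities `η = Pw + Ld/Λ`, `ξ = Pw − Ld/(1−Λ)`, `c = DP(P,1)`, `Pw` are analytic at a point where `P, Λ` are analytic and `Λ ∉ {0,1}`.
[folklore] -/
theorem analyticAt_structure {P Λ : ℝ × ℝ → ℝ} {q : ℝ × ℝ} (hP : AnalyticAt ℝ P q) (hΛ : AnalyticAt ℝ Λ q) (hL0 : Λ q ≠ 0) (hL1 : Λ q ≠ 1) :
    AnalyticAt ℝ (fun q' => fderiv ℝ P q' ((1 : ℝ), (0 : ℝ)) + fderiv ℝ Λ q' (P q', 1) / Λ q') q ∧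
      AnalyticAt ℝ (fun q' => fderiv ℝ P q' ((1 : ℝ), (0 : ℝ)) - fderiv ℝ Λ q' (P q', 1) / (1 - Λ q')) q ∧
      AnalyticAt ℝ (fun q' => fderiv ℝ P q' (P q', 1)) q ∧ AnalyticAt ℝ (fun q' => fderiv ℝ P q' ((1 : ℝ), (0 : ℝ))) q := by
  -- partial-derivative functions are analytic
  have hDP : ∀ v : ℝ × ℝ, AnalyticAt ℝ (fun q' => fderiv ℝ P q' v) q := fun v =>
    ((ContinuousLinearMap.apply ℝ ℝ v).analyticAt _).comp hP.fderiv
  have hDΛ : ∀ v : ℝ × ℝ, AnalyticAt ℝ (fun q' => fderiv ℝ Λ q' v) q := fun v =>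
    ((ContinuousLinearMap.apply ℝ ℝ v).analyticAt _).comp hΛ.fderiv
  -- `DΛ(P,1) = P·Lw + Lz`, `DP(P,1) = P·Pw + Pz`
  have eΛ : (fun q' : ℝ × ℝ => fderiv ℝ Λ q' (P q', 1)) =
      fun q' => P q' * fderiv ℝ Λ q' ((1 : ℝ), (0 : ℝ)) + 1 * fderiv ℝ Λ q' ((0 : ℝ), (1 : ℝ)) := by
    funext q'; rw [fderiv_pair_eq]
  have eP : (fun q' : ℝ × ℝ => fderiv ℝ P q' (P q', 1)) =
      fun q' => P q' * fderiv ℝ P q' ((1 : ℝ), (0 : ℝ)) + 1 * fderiv ℝ P q' ((0 : ℝ), (1 : ℝ)) := by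
    funext q'; rw [fderiv_pair_eq]
  have hLd : AnalyticAt ℝ (fun q' : ℝ × ℝ => fderiv ℝ Λ q' (P q', 1)) q := by
    rw [eΛ]; exact (hP.mul (hDΛ _)).add (analyticAt_const.mul (hDΛ _))
  have hc : AnalyticAt ℝ (fun q' : ℝ × ℝ => fderiv ℝ P q' (P q', 1)) q := by
    rw [eP]; exact (hP.mul (hDP _)).add (analyticAt_const.mul (hDP _))
  have h1L : AnalyticAt ℝ (fun q' => 1 - Λ q') q := analyticAt_const.sub hΛ
  have h1L0 : (fun q' => 1 - Λ q') q ≠ 0 := sub_ne_zero.mpr (Ne.symm hL1)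
  exact ⟨(hDP _).add (hLd.div hΛ hL0), (hDP _).sub (hLd.div h1L h1L0), hc, hDP _⟩


end Summit.NavierStokesRegularity.NavierStokesRegularity.Theorems.PoloidalWindowDoorPoloidalWindowRigidityUntwistedStuartTranslationAnalytic

end
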